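import Mathlib
import HarnessLib
import Literature.Probability.RandomMatrix.TwoQubitSeparabilityVolumes

/-!
# Two-qubit Hilbert–Schmidt fibre volumes at Bloch length `a`
# (Zhang–Jiang–Xie 2025, Props. 6.7 and 6.10; Lovas–Andai 2017; Huong–Khoi 2024)

Topic `Literature/Probability/RandomMatrix`. NAMED FACT (D-0014, statement only, `def … : Prop`)
extending `TwoQubitSeparabilityVolumes.lean` (which records only the zero-Bloch-vector fibre,
`ZhangJiangXie2025_qubit_fibre_separability_probability`, and the global `8/33`) to the fibres over
a marginal of Bloch length `a ∈ [0, 1/3)`. Requested by route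
`Summit.KontsevichZagierPeriods.KontsevichZagierPeriods.Theses.SpectrahedralScissors`, item
`SpectralShellDH` (stmt-KontsevichZagierPeriods-11068), whose VALUE side
`33·J(t)·vol₁₅(E_t) = I(t)·vol₁₅(D_t)` (`D_t` = two-qubit states with marginal Bloch length `≤ t`,
`E_t = D_t ∩ {λ_max ≤ ½}`, `J(t) = ∫₀ᵗ a²(1−a²)⁶ da`, `I(t) = ∫₀ᵗ a²(1−a)⁹(33a³+162a²+72a+8) da`)
is this fact integrated over the Bloch ball of radius `t` (Prop. 6.6 below: disintegration of the
Hilbert–Schmidt volume over the Bloch vector of the marginal, `(π/2)∫₀ᵗ a² · vol^a da`, plus the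
`U(2)`-invariance Prop. 6.5) — ordinary measure theory on the chart, not recorded as a fact.

## What is printed (arXiv:2507.02369, §6.1–6.2, pp. 14–16; held copy `paper:arxiv-2507.02369`)

`D^a(ℂ²⊗ℂ²) := {ρ ∈ D(ℂ²⊗ℂ²) : Tr₂ ρ = ½(1₂ + aσ₃)}` (p. 14, after Prop. 6.5: by `U(2)`-invariance
the conditioned separability probability depends only on the Bloch length `a = |r|`, so one may
take `r = (0,0,a)`); `D_ss(ℂ²⊗ℂ²) := {ρ : λ_max(ρ) ≤ ½}` (p. 15); `f(a) := vol_HS(D^a ∩ D_ss)` (p. 16,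
proof of Prop. 6.10); `vol_HS` = Hilbert–Schmidt volume.
* **Proposition 6.5** (p. 14): `P_sep(O r) = P_sep(r)` for `O ∈ SO(3)`, `|r| ≤ 1`.
* **Proposition 6.6** (p. 14): `vol_HS(D(ℂ²⊗ℂ²)) = ⅛ ∫_{B₁} vol_HS(D^r)[dr] = (π/2)∫₀¹ a² vol_HS(D^a) da`.
* **Proposition 6.7** ([Lovas2017]) (p. 14): "It holds that `vol_HS(D^a(ℂ²⊗ℂ²)) = vol_HS(D⁰(ℂ²⊗ℂ²))·(1−a²)⁶`,
  where `a ∈ [0,1)`. Moreover, `vol_HS(D⁰(ℂ²⊗ℂ²)) = π⁵/9676800`."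
* **Proposition 6.10** ([Huong2024]) (p. 16): "It holds that
  `f(a) = (π⁵/319334400)·(1−a)⁹(33a³+162a²+72a+8)`, `a ∈ [0, 1/3)`."
(`319334400 = 33 · 9676800`; at `a = 0` the ratio is `8/33`, Theorem 6.12 / Prop. 6.9.)

## Rendering

* Chart. `qubitBlochFibreMatrix a x`, `x ∈ ℝ¹²`: the trace-one Hermitian `4 × 4` matrix
  `ρ = [[X, Z], [Z*, D_a − X]]` with `X = [[x0, x2 + x3 i], [·, x1]]`,
  `Z = [[x4 + x5 i, x6 + x7 i], [x8 + x9 i, x10 + x11 i]]`, `D_a = diag((1+a)/2, (1−a)/2)`, i.e. the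
  fibre `X + Y = ½(1₂ + aσ₃)` of the block-trace marginal (trace over the SECOND = column-block
  factor in the convention of `TwoQubitSeparabilityVolumes.lean`, where the fibre chart
  `qubitFibreMatrix` is the case `a = 0`: `qubitBlochFibreMatrix_zero`). Which single-qubit
  marginal is conditioned is immaterial (factor swap is a coordinate permutation preserving the HS
  measure, positivity and `λ_max`), as recorded in the parent file.
* The fibres for different `a` are parallel translates of one `12`-dimensional affine subspace of
  the `15`-dimensional chart, with the SAME linear coordinates `x`, so the Hilbert–Schmidt measure
  on every fibre is one and the same constant multiple of `volume` on `Fin 12 → ℝ`; a printed ratio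
  of HS volumes of two subsets of the fibre `D^a` is therefore the ratio of their `volume`s. Only the
  RATIO `f(a) / vol_HS(D^a) = (1−a)⁹(33a³+162a²+72a+8) / (33(1−a²)⁶)` of Prop. 6.10 to Prop. 6.7 is
  recorded (cross-multiplied in `ℝ≥0∞`, both sets bounded), so no absolute HS normalisation enters.
* `λ_max(ρ) ≤ ½` is spelled `½·1 − ρ ≽ 0` (`Matrix.PosSemidef`), states are `ρ ≽ 0` (closed bodies,
  as in Zhang–Jiang–Xie / Huong–Khoi).

Grounds (value side only) `Summit.KontsevichZagierPeriods.KontsevichZagierPeriods.Theses.SpectrahedralScissors.SpectralShellDH`.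

## References

* [ZhangJiangXie2025] L. Zhang, X. Jiang, B. Xie, *One application of Duistermaat–Heckman measure
  in quantum information theory*, Quantum Inf. Comput. 25 (2025) 598–632, arXiv:2507.02369: §6.1
  Props. 6.5–6.7 (p. 14), Thm. 6.8 (p. 15), §6.2 Props. 6.9 (p. 15), 6.10 (p. 16), Thm. 6.12 (p. 18).
* [LovasAndai2017] A. Lovas, A. Andai, J. Phys. A 50 (2017) 295303, Thm. 1 (fibre volumes).
* [HuongKhoi2024] H. T. Huong, V. T. Khoi, J. Phys. A 57 (2024) 445304.
-/

noncomputable section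

open MeasureTheory
open scoped ENNReal ComplexOrder Matrix

namespace Literature.Probability.RandomMatrix

/-! ### Chart -/

/-- The fibre chart `x ∈ ℝ¹²` of trace-one Hermitian two-qubit matrices whose block-trace marginal
is `½(1₂ + aσ₃) = diag((1+a)/2, (1−a)/2)`: `X = [[x0, x2 + x3 i], [·, x1]]`,
`Z = [[x4 + x5 i, x6 + x7 i], [x8 + x9 i, x10 + x11 i]]`, `ρ = [[X, Z], [Z*, diag((1+a)/2,(1−a)/2) − X]]`
(Zhang–Jiang–Xie's conditioned state space `D^a`, Bloch vector `(0,0,a)`, before positivity is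
imposed). [cite: ZhangJiangXie2025, §6.1 (D^a(ℂ²⊗ℂ²), p. 14)] -/
def qubitBlochFibreMatrix (a : ℝ) (x : Fin 12 → ℝ) : Matrix (Fin 4) (Fin 4) ℂ :=
  !![((x 0 : ℝ) : ℂ), (⟨x 2, x 3⟩ : ℂ), (⟨x 4, x 5⟩ : ℂ), (⟨x 6, x 7⟩ : ℂ);
     (⟨x 2, -x 3⟩ : ℂ), ((x 1 : ℝ) : ℂ), (⟨x 8, x 9⟩ : ℂ), (⟨x 10, x 11⟩ : ℂ);
     (⟨x 4, -x 5⟩ : ℂ), (⟨x 8, -x 9⟩ : ℂ), (((1 + a) / 2 - x 0 : ℝ) : ℂ), (⟨-x 2, -x 3⟩ : ℂ);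
     (⟨x 6, -x 7⟩ : ℂ), (⟨x 10, -x 11⟩ : ℂ), (⟨-x 2, x 3⟩ : ℂ), (((1 - a) / 2 - x 1 : ℝ) : ℂ)]

/-- At Bloch length `0` the chart is the maximally-mixed-marginal fibre chart of the parent file.
[cite: ZhangJiangXie2025, §6.1 (D^𝐫, 𝐫 = 0)] -/
theorem qubitBlochFibreMatrix_zero (x : Fin 12 → ℝ) :
    qubitBlochFibreMatrix 0 x = qubitFibreMatrix x := by
  ext i j
  fin_cases i <;> fin_cases j <;> simp [qubitBlochFibreMatrix, qubitFibreMatrix]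

/-- The chart has trace one. [folklore] -/
theorem trace_qubitBlochFibreMatrix (a : ℝ) (x : Fin 12 → ℝ) :
    (qubitBlochFibreMatrix a x).trace = 1 := by
  simp [qubitBlochFibreMatrix, Matrix.trace, Fin.sum_univ_four]
  apply Complex.ext <;> (simp; try ring)

/-- The chart is Hermitian. [folklore] -/
theorem conjTranspose_qubitBlochFibreMatrix (a : ℝ) (x : Fin 12 → ℝ) :
    (qubitBlochFibreMatrix a x)ᴴ = qubitBlochFibreMatrix a x := by
  ext i j
  fin_cases i <;> fin_cases j <;>
    simp [qubitBlochFibreMatrix, Matrix.conjTranspose_apply] <;> apply Complex.ext <;> simp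

/-- The block trace over the second (column-block) factor of the chart is `diag((1+a)/2, (1−a)/2)`:
`ρ₀₀ + ρ₂₂ = (1+a)/2`, `ρ₁₁ + ρ₃₃ = (1−a)/2`, `ρ₀₁ + ρ₂₃ = 0` — the fibre condition
`Tr₂ ρ = ½(1₂ + aσ₃)`. [cite: ZhangJiangXie2025, §6.1 (D^a(ℂ²⊗ℂ²), p. 14)] -/
theorem blockTrace_qubitBlochFibreMatrix (a : ℝ) (x : Fin 12 → ℝ) :
    qubitBlochFibreMatrix a x 0 0 + qubitBlochFibreMatrix a x 2 2 = (((1 + a) / 2 : ℝ) : ℂ) ∧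
    qubitBlochFibreMatrix a x 1 1 + qubitBlochFibreMatrix a x 3 3 = (((1 - a) / 2 : ℝ) : ℂ) ∧
    qubitBlochFibreMatrix a x 0 1 + qubitBlochFibreMatrix a x 2 3 = 0 := by
  refine ⟨?_, ?_, ?_⟩ <;> (simp [qubitBlochFibreMatrix]; try (apply Complex.ext <;> (simp; try ring)))

/-! ### Named fact -/

/-- **Zhang–Jiang–Xie 2025, Prop. 6.7 ([Lovas–Andai 2017]) with Prop. 6.10 ([Huong–Khoi 2024]):
the `λ_max ≤ ½` fraction of the two-qubit fibre of Bloch length `a`.** Printed: "It holds that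
`vol_HS(D^a(ℂ²⊗ℂ²)) = vol_HS(D⁰(ℂ²⊗ℂ²))(1−a²)⁶`, where `a ∈ [0,1)`. Moreover
`vol_HS(D⁰(ℂ²⊗ℂ²)) = π⁵/9676800`" (Prop. 6.7) and "It holds that
`f(a) = (π⁵/319334400)(1−a)⁹(33a³+162a²+72a+8)`, `a ∈ [0,1/3)`" (Prop. 6.10), where
`f(a) = vol_HS(D^a ∩ D_ss)`, `D_ss = {ρ : λ_max(ρ) ≤ ½}`. Recorded as the ratio
`33(1−a²)⁶ · vol(D^a ∩ D_ss) = (1−a)⁹(33a³+162a²+72a+8) · vol(D^a)` on the fibre chart `ℝ¹²`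
(`319334400 = 33·9676800`; module docstring: constant Jacobian to the HS measure, the same for every
`a`). At `a = 0` this is `33·vol = 8·vol`, the parent file's
`ZhangJiangXie2025_qubit_fibre_separability_probability` (there `D⁰ ∩ D_ss = D⁰_sep`, Prop. 6.9).
Grounds the value side of route item `SpectrahedralScissors.SpectralShellDH` (item 11068 of the
Kontsevich–Zagier summit; fully qualified name in the module docstring).
[cite: ZhangJiangXie2025, Prop 6.7 (p. 14) and Prop 6.10 (p. 16)] [cite: LovasAndai2017, Theorem 1] [cite: HuongKhoi2024, main theorem] -/
def ZhangJiangXie2025_qubit_blochFibre_lambdaMax_ratio : Prop :=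
  ∀ a : ℝ, 0 ≤ a → a < 1 / 3 →
    ENNReal.ofReal (33 * (1 - a ^ 2) ^ 6) *
        volume {x : Fin 12 → ℝ | (qubitBlochFibreMatrix a x).PosSemidef ∧
          ((2 : ℂ)⁻¹ • (1 : Matrix (Fin 4) (Fin 4) ℂ) - qubitBlochFibreMatrix a x).PosSemidef} =
      ENNReal.ofReal ((1 - a) ^ 9 * (33 * a ^ 3 + 162 * a ^ 2 + 72 * a + 8)) *
        volume {x : Fin 12 → ℝ | (qubitBlochFibreMatrix a x).PosSemidef}

/-- Consistency with the parent file: at `a = 0` the fibre fact is the zero-Bloch-vector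
separability fraction `33·vol(D⁰ ∩ D_ss) = 8·vol(D⁰)`. [cite: ZhangJiangXie2025, Theorem 6.12 (proof)] -/
theorem ZhangJiangXie2025_qubit_blochFibre_lambdaMax_ratio.at_zero
    (h : ZhangJiangXie2025_qubit_blochFibre_lambdaMax_ratio) :
    ZhangJiangXie2025_qubit_fibre_separability_probability := by
  have h0 := h 0 le_rfl (by norm_num)
  have e1 : ENNReal.ofReal (33 * (1 - (0:ℝ) ^ 2) ^ 6) = 33 := by norm_num
  have e2 : ENNReal.ofReal ((1 - (0:ℝ)) ^ 9 * (33 * (0:ℝ) ^ 3 + 162 * 0 ^ 2 + 72 * 0 + 8)) = 8 := by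
    norm_num
  rw [e1, e2] at h0
  simpa [ZhangJiangXie2025_qubit_fibre_separability_probability, qubitBlochFibreMatrix_zero] using h0

end Literature.Probability.RandomMatrix

end
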